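import Mathlib
import HarnessLib
import Summits.HubbardSuperconductivity.HubbardSuperconductivity.Theorems.KLProgrammeKLRegimeTwoVolumeLipBaseRemeasure
import Summits.HubbardSuperconductivity.HubbardSuperconductivity.Theorems.KLProgrammeKLRegimeTwoVolumeLipBaseTransferDoor

/-!
# Route `KLProgramme` — crux K3 ENGINE (stmt-HubbardSuperconductivity-20437), stub (e) proof-input «(e)-D-ROWS», G-4 (composition): THE (Dμ) ROW WITH ITS
# BASE DISCHARGED TO GRID DATA
# (seat hubbard-kl-k3c4-p1 g24, VL lane; `--supports` 20437; DROWS-SCOPE-g24 v10 §11–§12, ledger N9)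

`…LipBaseRemeasure.klLipInputDiffSup_le_remeasured_of_base` (p711315) is the (Dμ) row of the two-volume Lipschitz tower with the base measured difference
`BD_base` discharged to profiles (`E_b` at deep pins, `ND_b` at all pins) of the sector-count-`0` base difference
`sectorPreimage F₀(bL) 𝒱⁽⁰⁾(bL) − klGlue (sectorPreimage F₀(L) 𝒱⁽⁰⁾(L))`.  Here both are discharged further:
* `E_b` by the G-4 door `…LipBaseTransferDoor.lipBaseDiff_pinned_le` (p711975: the grid → sector transfer `klLipBaseTransfer` with `Λ_T′`-weighted rows `cW′`,
  block covariance, and the grid profiles `N_g`, `N_g^{far}`, `E_g` (grid defect at `D₀g`-deep grid pins), `ND_g` (grid defect, all pins) — `E_g`/`ND_g` are route A's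
  datum `…LipBaseGridDefect.lipBaseGridDefect_pinned_le`, p712146), read at the `(D₀g + r_g)`-deep sector pins (a grid pin within `r_g` of such a pin is `D₀g`-deep,
  `gridDeep_of_tnorm_le`);
* `ND_b` CRUDELY by `N_b′ + N_b` (`sum_pinned_norm_kernel_sub_klGlue_le`: triangle inequality and `…LipTowerDefs.sum_pinned_norm_kernel_klGlue_eq`) — it only
  enters with the small far factor `τ = cW/(1+Λ_T(r+1))`.

* `gridDeep_of_tnorm_le` — position-level depth bookkeeping (`…TwoVolumeTorusBlocks.far_of_not_deep_of_deep`);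
* `sum_pinned_norm_kernel_sub_klGlue_le` — `Σ_{Y′∋x′}‖(W′ − klGlue W)_{m}(Y′)‖ ≤ Σ_{Y′∋x′}‖W′_m(Y′)‖ + Σ_{Y∋res x′}‖W_m(Y)‖`;
* `lipBaseDiff_pinned_le_crude` — the base difference at ANY pin is at most `N_b′ + N_b`;
* **`klLipInputDiffSup_le_remeasured_of_grid`** — the (Dμ) row at depth `D₀g + r_g + r` with `E_b := cW′ⁿ(cW′E_g + τ′ND_g) + (2cW′ⁿτ′N_g + n·cW′ⁿ(5τ′N_g + 2cW′N_g^{far}))`,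
  `τ′ = cW′/(1+Λ_T′(r_g+1))`, `ND_b := N_b′ + N_b`.

A composition of landed theorems; nothing asserts the (D) rows, stub (e), VL, K3 or superconductivity.
References: BGM 2006 §2.8, §3 [cite: BenfattoGiulianiMastropietro2006]; Salmhofer 1998 §4.
-/

noncomputable section

namespace Summit.HubbardSuperconductivity.HubbardSuperconductivity.Theorems.TwoVolumeLip

set_option linter.dupNamespace false -- summit = problem name (single-conjunct summit), D-0017

open Finset Literature.MathematicalPhysics.QuantumLattice GrassmannAlgebra Literature.Probability.LatticeModels
open Literature.MathematicalPhysics.QuantumLattice.FermiRG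
open Summit.HubbardSuperconductivity.HubbardSuperconductivity.Theorems.KLRegimeSplit
open Summit.HubbardSuperconductivity.HubbardSuperconductivity.Theorems.KLProgrammeLegKernels
open Summit.HubbardSuperconductivity.HubbardSuperconductivity.Theorems.DispersionFlow
open Summit.HubbardSuperconductivity.HubbardSuperconductivity.Theorems.EngineV8
open Summit.HubbardSuperconductivity.HubbardSuperconductivity.Theorems.TwoVolumeSource
open Summit.HubbardSuperconductivity.HubbardSuperconductivity.Theorems.TwoVolumeDefect

/-- **A site within torus distance `r` of a `(D + r)`-deep site is `D`-deep** (fine torus `(ℤ/(bL)ℤ)²` tiled by boxes of side `L`; position level). [folklore] -/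
theorem gridDeep_of_tnorm_le {L b D r : ℕ} [NeZero L] [NeZero (b * L)] {w z : TorusSite 2 (b * L)}
    (hw : ∀ j, D + r ≤ (w j).val % L ∧ (w j).val % L + (D + r) < L) (hz : Torus.tnorm (w - z) ≤ r) :
    ∀ j, D ≤ (z j).val % L ∧ (z j).val % L + D < L := by
  by_contra hc
  have hfar : r < Torus.tnorm (z - w) := far_of_not_deep_of_deep (d := 2) (M := b * L) (m := L) (b := b) rfl hc hw
  rw [← Torus.tnorm_neg, neg_sub] at hfar
  exact absurd hz (not_le.2 hfar)

section

variable {L b M : ℕ} [NeZero L] [NeZero (b * L)]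

/-- **Crude pinned profile of a difference against a glued element**: triangle inequality, and the glued element's pinned profile at a fine pin is the coarse
element's at the residue pin (`…LipTowerDefs.sum_pinned_norm_kernel_klGlue_eq`). -/
theorem sum_pinned_norm_kernel_sub_klGlue_le {N m : ℕ} (W' : GrassmannAlgebra ℂ (SpaceTimeIdx (b * L) M × SectorLeg N))
    (W : GrassmannAlgebra ℂ (SpaceTimeIdx L M × SectorLeg N)) (j : Fin m) (x' : SpaceTimeIdx (b * L) M × SectorLeg N) :
    ∑ Y' ∈ univ.filter (fun Y' : Fin m → SpaceTimeIdx (b * L) M × SectorLeg N => Y' j = x'), ‖kernel ℂ (W' - klGlue L b M N W) m Y'‖ ≤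
      ∑ Y' ∈ univ.filter (fun Y' : Fin m → SpaceTimeIdx (b * L) M × SectorLeg N => Y' j = x'), ‖kernel ℂ W' m Y'‖ +
        ∑ Y ∈ univ.filter (fun Y : Fin m → SpaceTimeIdx L M × SectorLeg N => Y j = (klBlockEquiv L b M N x').2), ‖kernel ℂ W m Y‖ := by
  rw [← sum_pinned_norm_kernel_klGlue_eq W j x', ← sum_add_distrib]
  exact sum_le_sum fun Y' _ => by rw [kernel_sub']; exact norm_sub_le _ _

/-- **The base difference at ANY pin is at most `N_b′ + N_b`** (crude; used for the all-pins profile `ND_b`, which only enters with the far factor). -/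
theorem lipBaseDiff_pinned_le_crude (β U μ : ℝ) (K : TrigPolyC4v) {n : ℕ} (q : Fin (n + 1)) {Nb Nb' : ℝ}
    (hNb : ∀ y, ∑ Y ∈ univ.filter (fun Y : Fin (n + 1) → SpaceTimeIdx L M × SectorLeg (sectorCount 0) => Y q = y),
      ‖kernel ℂ (sectorPreimage β (klAnisoFamily L M β μ K klE0 0) (klEffectiveAction L M β U μ K klE0 0)) (n + 1) Y‖ ≤ Nb)
    (hNb' : ∀ y', ∑ Y' ∈ univ.filter (fun Y' : Fin (n + 1) → SpaceTimeIdx (b * L) M × SectorLeg (sectorCount 0) => Y' q = y'),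
      ‖kernel ℂ (sectorPreimage β (klAnisoFamily (b * L) M β μ K klE0 0) (klEffectiveAction (b * L) M β U μ K klE0 0)) (n + 1) Y'‖ ≤ Nb')
    (y' : SpaceTimeIdx (b * L) M × SectorLeg (sectorCount 0)) :
    ∑ Y' ∈ univ.filter (fun Y' : Fin (n + 1) → SpaceTimeIdx (b * L) M × SectorLeg (sectorCount 0) => Y' q = y'),
        ‖kernel ℂ (sectorPreimage β (klAnisoFamily (b * L) M β μ K klE0 0) (klEffectiveAction (b * L) M β U μ K klE0 0) -
            klGlue L b M (sectorCount 0) (sectorPreimage β (klAnisoFamily L M β μ K klE0 0) (klEffectiveAction L M β U μ K klE0 0))) (n + 1) Y'‖ ≤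
      Nb' + Nb :=
  (sum_pinned_norm_kernel_sub_klGlue_le _ _ q y').trans (add_le_add (hNb' y') (hNb _))

end

section

variable {L b M : ℕ} [NeZero L] [NeZero (b * L)] [NeZero M]

set_option maxHeartbeats 400000 in -- large statement
/-- **The (Dμ) row with the base discharged to GRID data** (see the module docstring). -/
theorem klLipInputDiffSup_le_remeasured_of_grid {β : ℝ} (hβ : 0 < β) (U μ : ℝ) (K : TrigPolyC4v) {d : ℕ} (hd : 2 ≤ d) {k : ℕ} (hk : 1 ≤ k) (n D₀g rg r jr : ℕ) (hD₀g : 2 * rg ≤ D₀g)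
    (hD₀ : 2 * r ≤ D₀g + rg) {ΛT cW : ℝ} (hΛT : 0 ≤ ΛT) (hΛr : ΛT ≤ klScale klE0 jr) (hcW : 0 ≤ cW)
    (hrow : ∀ k' ∈ range k, ∀ x, ∑ y', ‖klJump (b * L) M β μ K (d * k - 1) (d * k') x y'‖ *
      klScaleWt (b * L) M β jr {latticeLegPos (2 * (2 * M)) x, latticeLegPos (2 * (2 * M)) y'} ≤ cW)
    (hcol : ∀ k' ∈ range k, ∀ y', ∑ x, ‖klJump (b * L) M β μ K (d * k - 1) (d * k') x y'‖ *
      klScaleWt (b * L) M β jr {latticeLegPos (2 * (2 * M)) x, latticeLegPos (2 * (2 * M)) y'} ≤ cW)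
    (hrow0 : ∀ x, ∑ y', ‖klJump (b * L) M β μ K (d * k - 1) 0 x y'‖ *
      klScaleWt (b * L) M β jr {latticeLegPos (2 * (2 * M)) x, latticeLegPos (2 * (2 * M)) y'} ≤ cW)
    (hcol0 : ∀ y', ∑ x, ‖klJump (b * L) M β μ K (d * k - 1) 0 x y'‖ *
      klScaleWt (b * L) M β jr {latticeLegPos (2 * (2 * M)) x, latticeLegPos (2 * (2 * M)) y'} ≤ cW)
    {Nb Nbfar Nb' : ℝ} (hNb0 : 0 ≤ Nb) (hNbfar0 : 0 ≤ Nbfar) (hNb'0 : 0 ≤ Nb')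
    (hNb : ∀ (q : Fin (n + 1)) y, ∑ Y ∈ univ.filter (fun Y : Fin (n + 1) → SpaceTimeIdx L M × SectorLeg (sectorCount 0) => Y q = y),
      ‖kernel ℂ (sectorPreimage β (klAnisoFamily L M β μ K klE0 0) (klEffectiveAction L M β U μ K klE0 0)) (n + 1) Y‖ ≤ Nb)
    (hNbfar : ∀ (q : Fin (n + 1)) y (i : Fin (n + 1)),
      ∑ Y ∈ univ.filter (fun Y : Fin (n + 1) → SpaceTimeIdx L M × SectorLeg (sectorCount 0) => Y q = y ∧ r < Torus.tnorm ((Y q).1.2 - (Y i).1.2)),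
        ‖kernel ℂ (sectorPreimage β (klAnisoFamily L M β μ K klE0 0) (klEffectiveAction L M β U μ K klE0 0)) (n + 1) Y‖ ≤ Nbfar)
    (hNb' : ∀ (q : Fin (n + 1)) y', ∑ Y' ∈ univ.filter (fun Y' : Fin (n + 1) → SpaceTimeIdx (b * L) M × SectorLeg (sectorCount 0) => Y' q = y'),
      ‖kernel ℂ (sectorPreimage β (klAnisoFamily (b * L) M β μ K klE0 0) (klEffectiveAction (b * L) M β U μ K klE0 0)) (n + 1) Y'‖ ≤ Nb')
    -- G-4: the grid → sector transfer of the fine volume (weighted rows at `Λ_T′`, block covariance) and the grid data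
    {ΛT' cW' : ℝ} (hΛT' : 0 ≤ ΛT') (hcW' : 0 ≤ cW')
    (hrowT : ∀ x, ∑ y', ‖klLipBaseTransfer (b * L) M β μ K x y'‖ * (1 + ΛT' * (Torus.tnorm (x.1.2 - y'.1.1.2) : ℝ)) ≤ cW')
    (hcolT : ∀ y', ∑ x, ‖klLipBaseTransfer (b * L) M β μ K x y'‖ * (1 + ΛT' * (Torus.tnorm (x.1.2 - y'.1.1.2) : ℝ)) ≤ cW')
    (hcov : ∀ (δ B' B : Fin 2 → Fin b) (xbar : SpaceTimeIdx L M × SectorLeg (sectorCount 0)) (y : GridLeg (GridPoint L (klGridN M))),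
      ‖klLipBaseTransfer (b * L) M β μ K ((klBlockEquiv L b M (sectorCount 0)).symm (B' + δ, xbar)) ((klGridBlockEquiv L b M).symm (B + δ, y))‖ =
        ‖klLipBaseTransfer (b * L) M β μ K ((klBlockEquiv L b M (sectorCount 0)).symm (B', xbar)) ((klGridBlockEquiv L b M).symm (B, y))‖)
    {Ng Ngfar Eg NDg : ℝ} (hNg0 : 0 ≤ Ng) (hNgfar0 : 0 ≤ Ngfar) (hEg0 : 0 ≤ Eg) (hNDg0 : 0 ≤ NDg)
    (hNg : ∀ (q : Fin (n + 1)) y, ∑ Y ∈ univ.filter (fun Y : Fin (n + 1) → GridLeg (GridPoint L (klGridN M)) => Y q = y),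
      ‖kernel ℂ (klGridActionZero L M β U μ K) (n + 1) Y‖ ≤ Ng)
    (hNgfar : ∀ (q : Fin (n + 1)) y (i : Fin (n + 1)),
      ∑ Y ∈ univ.filter (fun Y : Fin (n + 1) → GridLeg (GridPoint L (klGridN M)) => Y q = y ∧ rg < Torus.tnorm ((Y q).1.1.2 - (Y i).1.1.2)),
        ‖kernel ℂ (klGridActionZero L M β U μ K) (n + 1) Y‖ ≤ Ngfar)
    (hEg : ∀ (q : Fin (n + 1)) (y' : GridLeg (GridPoint (b * L) (klGridN M))), (∀ j, D₀g ≤ (y'.1.1.2 j).val % L ∧ (y'.1.1.2 j).val % L + D₀g < L) →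
      ∑ Y' ∈ univ.filter (fun Y' : Fin (n + 1) → GridLeg (GridPoint (b * L) (klGridN M)) => Y' q = y'),
        ‖kernel ℂ (klGridActionZero (b * L) M β U μ K - klGridGlue L b M (klGridActionZero L M β U μ K)) (n + 1) Y'‖ ≤ Eg)
    (hNDg : ∀ (q : Fin (n + 1)) y', ∑ Y' ∈ univ.filter (fun Y' : Fin (n + 1) → GridLeg (GridPoint (b * L) (klGridN M)) => Y' q = y'),
        ‖kernel ℂ (klGridActionZero (b * L) M β U μ K - klGridGlue L b M (klGridActionZero L M β U μ K)) (n + 1) Y'‖ ≤ NDg)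
    {N Nfar : ℕ → ℝ} (hN0 : ∀ k', 0 ≤ N k') (hNfar0 : ∀ k', 0 ≤ Nfar k')
    (hN : ∀ k' ∈ range k, ∀ (q : Fin (n + 1)) (y : SpaceTimeIdx L M × SectorLeg (sectorCount (d * k'))),
      ∑ Y ∈ univ.filter (fun Y : Fin (n + 1) → SpaceTimeIdx L M × SectorLeg (sectorCount (d * k')) => Y q = y),
        ‖kernel ℂ (klLipBorn L M β U μ K d k') (n + 1) Y‖ ≤ N k')
    (hNfar : ∀ k' ∈ range k, ∀ (q : Fin (n + 1)) (y : SpaceTimeIdx L M × SectorLeg (sectorCount (d * k'))) (i : Fin (n + 1)),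
      ∑ Y ∈ univ.filter (fun Y : Fin (n + 1) → SpaceTimeIdx L M × SectorLeg (sectorCount (d * k')) =>
          Y q = y ∧ r < Torus.tnorm ((Y q).1.2 - (Y i).1.2)), ‖kernel ℂ (klLipBorn L M β U μ K d k') (n + 1) Y‖ ≤ Nfar k') :
    klLipInputDiffSup L b M β U μ K d k (n + 1) (D₀g + rg + r) ≤
      (cW ^ n * (cW * (cW' ^ n * (cW' * Eg + cW' / (1 + ΛT' * ((rg : ℝ) + 1)) * NDg) + (2 * cW' ^ n * (cW' / (1 + ΛT' * ((rg : ℝ) + 1))) * Ng + n * cW' ^ n * (5 * (cW' / (1 + ΛT' * ((rg : ℝ) + 1))) * Ng + 2 * cW' * Ngfar))) + cW / (1 + ΛT * ((r : ℝ) + 1)) * (Nb' + Nb)) +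
          (2 * cW ^ n * (cW / (1 + ΛT * ((r : ℝ) + 1))) * Nb + n * cW ^ n * (5 * (cW / (1 + ΛT * ((r : ℝ) + 1))) * Nb + 2 * cW * Nbfar))) +
        ∑ k' ∈ range k,
          (cW ^ n * (cW * klLipBornDiffSup L b M β U μ K d k' (n + 1) (D₀g + rg) +
              cW / (1 + ΛT * ((r : ℝ) + 1)) * klLipBornDiffSup L b M β U μ K d k' (n + 1) 0) +
            (2 * cW ^ n * (cW / (1 + ΛT * ((r : ℝ) + 1))) * N k' +
              n * cW ^ n * (5 * (cW / (1 + ΛT * ((r : ℝ) + 1))) * N k' + 2 * cW * Nfar k'))) := by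
  have hτ' : 0 ≤ cW' / (1 + ΛT' * ((rg : ℝ) + 1)) := by positivity
  refine klLipInputDiffSup_le_remeasured_of_base hβ U μ K hd hk n (D₀g + rg) r jr hD₀ hΛT hΛr hcW hrow hcol hrow0 hcol0 hNb0 hNbfar0
    (by positivity) (by positivity) hNb hNbfar (fun q y' hy' => ?_) (fun q y' => lipBaseDiff_pinned_le_crude β U μ K q (hNb q) (hNb' q) y') hN0 hNfar0 hN hNfar
  have hw' : ∀ j, D₀g + rg ≤ (y'.1.2 j).val % L ∧ (y'.1.2 j).val % L + (D₀g + rg) < L := mem_klDeepPins.1 hy'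
  exact lipBaseDiff_pinned_le hβ U μ K hΛT' hcW' hrowT hcolT hcov q y' D₀g rg hD₀g hw' hNg0 hNgfar0 hEg0 hNDg0 (hNg q) (hNgfar q)
    (fun y'' hy'' => hEg q y'' (gridDeep_of_tnorm_le hw' hy'')) (hNDg q)

end

end Summit.HubbardSuperconductivity.HubbardSuperconductivity.Theorems.TwoVolumeLip

end
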